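import Summits.QuantumAdvantage.QuantumAdvantage.Theses.MobiusLadder
import Literature.NumberTheory.LFunctions.GRHCharacterPrimeSums

/-!
# Sketch — crux-ideate r2 k5, crux `MobiusLadder.LiouvilleNotPPoly` (stmt-QuantumAdvantage-1389)
# idea `character-sketch-decoder`: λ on n-bit integers factors through O(n) Jacobi symbols

Signatures only (they must elaborate; nothing here is a registered stub). The objects:

* a SKETCH is a tuple of moduli `D : Fin m → ℕ`; its value at `N` is the vector of Jacobi symbols
  `(J(D i | N))_i ∈ {0, ±1}^m` (the tree's `jacobiSym`, `N` at the bottom: completely multiplicative in `N`);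
* `PairSeparating n m D`: any two `n`-rough `N₁, N₂ < 2^n` whose odd-exponent prime supports differ are told
  apart by a NONZERO coordinate;
* FIRST LEMMA `SketchExists` (unconditional: Pólya–Vinogradov for the primitive character `D ↦ J(D | P)`,
  `Literature.NumberTheory.Sieve.LargeSieveCharacters.polyaVinogradov` + `isPrimitive_jacobiChar`, and a
  counting / union-bound argument over the `< 2^{2n}` pairs): sketches of size `4n` with `3n`-bit moduli exist;
* hence `LiouvilleFactorsThroughSketch`: `λ(N) = Λ(J(D · | N))` on the `n`-rough `N < 2^n` for SOME decoder `Λ`;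
* `CharDecoderEasy` (some poly-size sketch has poly-size B₂ decoder circuits) refutes the crux
  (`DecoderRefutesCrux`), i.e. the crux carries the CHARACTER DEBT `¬ CharDecoderEasy` — the nonlinear,
  many-character generalisation of TwinDebt (`exists_nonInert_prime_of_liouvilleNotPPoly` = the case of a
  decoder reading ONE coordinate);
* the first rung of the decoder ladder beyond twins, `NoLowDegreeCharDecoder` (GRH): no F₂-polynomial of
  degree ≤ n / (C log₂ n) in the sketch bits decodes λ, for ANY poly-size sketch of poly-bit moduli.
-/

set_option linter.dupNamespace false -- D-0017: single-problem summit ⇒ `QuantumAdvantage.QuantumAdvantage` by design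

namespace Summit.QuantumAdvantage.QuantumAdvantage.Cruxes.LiouvilleNotPPoly.CharSketch

open Filter Literature.Computability.Complexity

/-- `N` is `B`-rough: every prime factor exceeds `B` (so `1` is rough). -/
def Rough (B N : ℕ) : Prop := ∀ p : ℕ, p.Prime → p ∣ N → B < p

/-- Same squarefree-kernel class: the primes occurring to an ODD power agree. -/
def SameKernel (N₁ N₂ : ℕ) : Prop := ∀ p : ℕ, p.Prime → (Odd (N₁.factorization p) ↔ Odd (N₂.factorization p))

/-- The sketch value of `N` for the moduli `D`. -/
def sketch {m : ℕ} (D : Fin m → ℕ) (N : ℕ) : Fin m → ℤ := fun i => jacobiSym (D i) N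

/-- `D` PAIR-SEPARATES level `n`: two `n`-rough `N₁, N₂ < 2^n` in different kernel classes differ at a
coordinate that is nonzero (hence `±1`) for both. -/
def PairSeparating (n m : ℕ) (D : Fin m → ℕ) : Prop :=
  ∀ N₁ N₂ : ℕ, 0 < N₁ → N₁ < 2 ^ n → 0 < N₂ → N₂ < 2 ^ n → Rough n N₁ → Rough n N₂ →
    ¬ SameKernel N₁ N₂ → ∃ i, sketch D N₁ i ≠ 0 ∧ sketch D N₂ i ≠ 0 ∧ sketch D N₁ i ≠ sketch D N₂ i

/-- **FIRST LEMMA (unconditional).** Linear-size sketches with cubic-bit moduli exist for all large `n`. -/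
def SketchExists : Prop :=
  ∀ᶠ n : ℕ in atTop, ∃ D : Fin (4 * n) → ℕ, (∀ i, 0 < D i ∧ D i ≤ 2 ^ (3 * n)) ∧ PairSeparating n (4 * n) D

/-- The per-pair estimate behind it (Pólya–Vinogradov + coprimality counting): for `n ≥ n₀`, every pair of
`n`-rough `N₁, N₂ < 2^n` in different kernel classes is separated (nonzero, unequal symbol) by at least a
third of the moduli `D ∈ [1, 2^{3n}]`. Union bound: `2^{2n} · (2/3)^{4n} < 1`. -/
def PairSeparatedByThird : Prop :=
  ∀ᶠ n : ℕ in atTop, ∀ N₁ N₂ : ℕ, 0 < N₁ → N₁ < 2 ^ n → 0 < N₂ → N₂ < 2 ^ n → Rough n N₁ → Rough n N₂ →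
    ¬ SameKernel N₁ N₂ →
      2 ^ (3 * n) ≤ 3 * ((Finset.Icc 1 (2 ^ (3 * n))).filter fun D : ℕ =>
        jacobiSym D N₁ ≠ 0 ∧ jacobiSym D N₂ ≠ 0 ∧ jacobiSym D N₁ ≠ jacobiSym D N₂).card

/-- **Normal form.** On the `n`-rough `N < 2^n`, `λ` is SOME function `Λ` of the sketch alone. -/
def LiouvilleFactorsThroughSketch : Prop :=
  ∀ᶠ n : ℕ in atTop, ∃ D : Fin (4 * n) → ℕ, (∀ i, 0 < D i ∧ D i ≤ 2 ^ (3 * n)) ∧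
    ∃ Λ : (Fin (4 * n) → ℤ) → ℤ, ∀ N : ℕ, 0 < N → N < 2 ^ n → Rough n N →
      ArithmeticFunction.liouville N = Λ (sketch D N)

/-- Two bits per trit: bit `2i` = `[vᵢ = −1]`, bit `2i+1` = `[vᵢ = 0]`. -/
def encTrits {m : ℕ} (v : Fin m → ℤ) : Fin (2 * m) → Bool := fun j =>
  if j.val % 2 = 0 then decide (v ⟨j.val / 2, by omega⟩ = -1) else decide (v ⟨j.val / 2, by omega⟩ = 0)

/-- **CHARACTER-DECODER EASY**: some polynomial-size sketch of polynomial-bit moduli admits polynomial-size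
B₂ decoder circuits computing `[λ N = −1]` from the sketch of `N` ALONE, on every `n`-rough `N < 2^n`
(a promise statement: off the sketch image the circuit is unconstrained). -/
def CharDecoderEasy : Prop :=
  ∃ (m : ℕ → ℕ) (D : (n : ℕ) → Fin (m n) → ℕ) (p : Polynomial ℕ),
    (∀ n, m n ≤ p.eval n) ∧ (∀ n i, D n i ≤ 2 ^ p.eval n) ∧
    ∀ᶠ n : ℕ in atTop, ∃ C : Circuit (Fin (2 * m n)), C.IsOver B2 ∧ C.size ≤ p.eval n ∧
      ∀ N : ℕ, 0 < N → N < 2 ^ n → Rough n N →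
        (C.eval (encTrits (sketch (D n) N)) = true ↔ ArithmeticFunction.liouville N = -1)

/-- **The decoder road refutes the crux** (provable now: strip the `n`-smooth part by trial division,
Jacobi symbols are in CodeFP — `stub_jacobiSymCodeFP` — then run the decoder; Adleman-free). -/
def DecoderRefutesCrux : Prop :=
  CharDecoderEasy → ¬ Summit.QuantumAdvantage.QuantumAdvantage.Theses.MobiusLadder.LiouvilleNotPPoly

/-- **Character debt** (contrapositive): the crux forces EVERY polynomial character decoder to fail. -/
def CharacterDebt : Prop :=
  Summit.QuantumAdvantage.QuantumAdvantage.Theses.MobiusLadder.LiouvilleNotPPoly → ¬ CharDecoderEasy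

/-- Sketch bits over `F₂`: `xᵢ(N) = [J(Dᵢ | N) = −1]`. -/
def sketchBits {m : ℕ} (D : Fin m → ℕ) (N : ℕ) : Fin m → ZMod 2 :=
  fun i => if jacobiSym (D i) N = -1 then 1 else 0

/-- Multiplicative independence modulo squares (no redundant coordinate). -/
def MultIndep {m : ℕ} (D : Fin m → ℕ) : Prop :=
  ∀ S : Finset (Fin m), S.Nonempty → ¬ IsSquare (∏ i ∈ S, D i)

/-- **RUNG 2 of the decoder ladder (GRH): no low-degree character decoder.** For every polynomial bound,
eventually in `n`: for every sketch of `≤ p(n)` multiplicatively independent moduli of `≤ p(n)` bits and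
every `P ∈ F₂[x]` of total degree `d` with `d · C · log₂ n ≤ n`, `P ∘ sketchBits` is NOT `[λ = −1]` on the
`n`-rough `N < 2^n`; `C` depends on the polynomial bound `p` (the span step needs
`2^{n/(d+1)} ≥ (m · bits)^{2+o(1)}`). (Engine: complete multiplicativity makes the degree-`d` form of `P` vanish on
`x(p₁), …, x(p_d)` for primes `p_i < 2^{n/(d+1)}`, which SPAN `F₂^m` by GRH prime-character counts
(`grh_primeCharSum_le`, PROVED as a GRH-implication); descend to degree 1 = a Liouville twin, excluded by
the same counts. Degree 1 with ONE coordinate is TwinDebt's GRH case `twinFreeDensity_of_GRH`.) -/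
def NoLowDegreeCharDecoder : Prop :=
  ∀ p : Polynomial ℕ, ∃ C : ℕ, 0 < C ∧ ∀ᶠ n : ℕ in atTop, ∀ m : ℕ, m ≤ p.eval n →
    ∀ D : Fin m → ℕ, (∀ i, 0 < D i ∧ D i ≤ 2 ^ p.eval n) → MultIndep D →
      ∀ P : MvPolynomial (Fin m) (ZMod 2), P.totalDegree * (C * Nat.log 2 n) ≤ n →
        ∃ N : ℕ, 0 < N ∧ N < 2 ^ n ∧ Rough n N ∧
          ¬ (MvPolynomial.eval (sketchBits D N) P = 1 ↔ ArithmeticFunction.liouville N = -1)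

/-- The GRH-conditional form in the tree's hypothesis style (as `twinFreeDensity_of_GRH`). -/
def NoLowDegreeCharDecoderOfGRH : Prop :=
  Literature.NumberTheory.LFunctions.GeneralizedRiemannHypothesis → NoLowDegreeCharDecoder

/-- **RUNG 3 (open, refuters first): no character PERCEPTRON.** No polynomial-size sketch and real weights
make `λ(N) = sgn(w₀ + Σᵢ wᵢ J(Dᵢ | N))` on the `n`-rough `N < 2^n`, eventually. -/
def NoThresholdCharDecoder : Prop :=
  ∀ p : Polynomial ℕ, ∀ᶠ n : ℕ in atTop, ∀ m : ℕ, m ≤ p.eval n →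
    ∀ D : Fin m → ℕ, (∀ i, 0 < D i ∧ D i ≤ 2 ^ p.eval n) → ∀ w₀ : ℝ, ∀ w : Fin m → ℝ,
      ∃ N : ℕ, 0 < N ∧ N < 2 ^ n ∧ Rough n N ∧
        (ArithmeticFunction.liouville N : ℝ) * (w₀ + ∑ i, w i * (jacobiSym (D i) N : ℝ)) ≤ 0

/-- Sanity: the objects typecheck against the crux decl. -/
example : Prop := SketchExists ∧ PairSeparatedByThird ∧ LiouvilleFactorsThroughSketch ∧ DecoderRefutesCrux ∧
  CharacterDebt ∧ NoLowDegreeCharDecoderOfGRH ∧ NoThresholdCharDecoder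

/-- Trivial direction recorded for the triage: `CharacterDebt ↔ DecoderRefutesCrux` (pure logic). -/
theorem characterDebt_iff : CharacterDebt ↔ DecoderRefutesCrux :=
  ⟨fun h hE hX => h hX hE, fun h hX hE => h hE hX⟩

end Summit.QuantumAdvantage.QuantumAdvantage.Cruxes.LiouvilleNotPPoly.CharSketch
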